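import Summits.QuantumFields.BalabanUV.T4Continuum.Support.FreeTowerEntryDecay
import Summits.QuantumFields.BalabanUV.T4Continuum.Support.BlockSumDecay
import Summits.QuantumFields.BalabanUV.T4Continuum.Support.WeightedRowSumResolvent

/-!
# T⁴ programme, NE2 (U1a) sub-row Δ3 (`T4-U1a.S-NE2-D3-WALK°`) — `hdec` AT SMALL COUPLING: for every perturbation family with a
# level-uniform exponentially WEIGHTED ROW-SUM bound (bounded potentials, finite-range bounded MODELS) and every coupling
# `‖t‖ < (W_G·π)⁻¹`, the King-averaged colour tower `pertCovC P t k` has level-uniform entry decay on the unit torus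

NE2 formalisation swarm `b2b-balaban-t4-ne2-formalise-*`, leaf prover 05 (gen 5); file B of the supplier item «NE2-Δ3-SMALL-COUPLING»
(INTENT CLAIMS.log 2026-08-20), on top of: this seat's `Support/FreeTowerEntryDecay` (p220045: the `U = 1` discharge and the block
bookkeeping `block_cond_iff` / `sum_block_comp_ite_const`), the row owner's `Support/BlockSumDecay` (p219633: the SHAPE `BlockL1Decay` and
`hdec_pertCovC_of_blockL1`), file A `Support/WeightedRowSumResolvent` (the resolvent bound in weighted row-sum norm), and pv15-g12's
`Literature/…/B5G110BlockRowSum.weighted_row_sum_le'` ([Balaban1984PropagatorsI] Prop. 1.2 (1.110) p.35 in exponentially weighted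
`ℓ^∞ → ℓ^∞` currency for `G = Δ_1⁻¹`, `n`-uniform).

WHAT IS PROVED (`a = 1`, dimension written `d + 1` — physical dimension 4 is `d = 3` —, every `L`, every torus `M`, every `o`):
 * §2 `prtk_prtQ_eq_iff` / `prtk_prtQK_eq_iff`: the owner's iterated parent `prtk prtQK k u = x` IS King's `L^k`-block condition
   (colour kept, component kept, site values divided by `n_k`; `BalabanAveragedTowerModes.val_par`);
 * §3 `torusSupNorm_rep_triangle` (the block distance is a pseudo-metric) and **`wrow_calGlev_kron_le`**: for `δ′ < min(δ₁, δ₂)` the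
   weighted row sums `Σ_j e^{δ′·|blk i − blk j|_{T₁,∞}}·‖(𝒢^{(k)} ⊗ 1)(i,j)‖` are `≤ W_G(d,δ′) := C₁·K(δ₁−δ′) + (d+1)·C₂·K(δ₂−δ′)`
   (`K = B4Sect5Proof.latticeConst`, `C₁, C₂, δ₁, δ₂` pv15's) — uniform in `k` and in the volume;
 * §4 `wrow_pert_inv_le` (file A on `D = Δ_1^{(k)} ⊗ 1`): `(Δ_1^{(k)} ⊗ 1 + tP_k)⁻¹` exists with weighted row sums
   `≤ W_G/(1 − ‖t‖·W_G·π)`; **`blockL1Decay_of_wrow`**: a level-uniform weighted row-sum bound `W` for a tower of colour-lifted fine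
   kernels gives the owner's SHAPE `BlockL1Decay (prtQK) (L^{d+1}) dist₀ X W δ′` (the `n_k^{d+1}` rows of a block);
   **`hdec_pertCovC_small`**: `hP : ∀ k i, Σ_j e^{δ′ρ}‖P k i j‖ ≤ π`, `‖t‖·W_G·π < 1` ⟹
   `∀ k, EntryDecay dist₀ (pertCovC L M 1 _ P t k) (W_G/(1 − ‖t‖W_Gπ)) δ′` (the owner's `hdec_pertCovC_of_blockL1` BY NAME);
   `wrow_diagonal_le` (bounded potentials `diag w`, `‖w‖ ≤ α`, have weighted row sums `≤ α` — the non-vacuous instance, kernel `example`);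
   `decayStations_pertCovC_small` (the owner's `decayStations_pertCovC` with `hdec` DISCHARGED under the perturbation laws AND `hP`).
   `dist₀` is the sup-distance of the unit torus `Π_ν ℤ/M_ν` on value representatives, as in `FreeTowerEntryDecay`.

HONEST FRAMING (T4-DAG p. 1).  MODEL LEVEL: perturbations bounded in the weighted `ℓ^∞ → ℓ^∞` norm (potentials, finite-range bounded
kernels); NOT tier B's `balabanPert` — its first-order pieces are unbounded alone and would need weighted row sums of `∇𝒢` (not in the
tree); `a = 1` (pv15's convention); constants and rates crude and ours; nothing printed asserted — (1.110) p.35 is a TEXT LOCATION; sub-row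
Δ3 NOT closed for Bałaban's carrier; nothing of NE3; **NE2 (U1a) NOT PROVED**; spine PROVED 0/9; NOT infinite volume, NOT a mass gap, NOT
Clay.  HONEST DEPENDENCY: continuum YM on T⁴ ⇐ BetaPertH ∧ nine spine estimates (0/9 proved); BetaPertH ⇐ (D1) ∧
(D4) ∧ CAP+tail; G-an2-4 gates asym, D1 and NE2/3/4.  ABSOLUTE RULE kept; no `def … : Prop` fact; no definition;
no `sorry`.
-/

noncomputable section

open scoped BigOperators ComplexConjugate Matrix Kronecker
open Finset

namespace Summit.QuantumFields.BalabanUV.T4Continuum.SmallCouplingEntryDecay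

open Summit.QuantumFields.BalabanUV.T4Continuum.WeightedRowSumResolvent (wrow_inv_add_smul_le)
/-! ## §2 King's iterated parent is the `L^k`-block: `prtk prtQK k u = x` read on values -/

section KingParent

open Literature.MathematicalPhysics.QuantumFieldTheory.Balaban1983to89.B5Prop11Plancherel (Tor fine)
open Literature.MathematicalPhysics.QuantumFieldTheory.Balaban1983to89.B5G183RateUnitTower (lev)
open Summit.QuantumFields.BalabanUV.T4Continuum.BalabanAveragedTowerUnit (idx)
open Summit.QuantumFields.BalabanUV.T4Continuum.BalabanAveragedTowerModes (par val_par)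
open Summit.QuantumFields.BalabanUV.T4Continuum.BlockSumDecay (prtk prtQ prtQK)

variable {d : ℕ} (L : ℕ) [NeZero L] (M : Fin d → ℕ) [hM : ∀ μ, NeZero (M μ)]
variable {o : Type*}

/-- the iterated parent keeps the component and divides the site values by `n_k = L^k`. [folklore] -/
theorem prtk_prtQ_spec : ∀ (k : ℕ) (u : idx L M k),
    (prtk (ι := fun k => idx L M k) (prtQ L M) k u).2 = u.2 ∧ ∀ ν, ((prtk (ι := fun k => idx L M k) (prtQ L M) k u).1 ν).val = (u.1 ν).val / lev L k
  | 0, u => ⟨rfl, fun ν => by simp [prtk, lev]⟩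
  | k + 1, u => by
      obtain ⟨h2, h1⟩ := prtk_prtQ_spec k (prtQ L M k u)
      refine ⟨by rw [prtk]; exact h2, fun ν => ?_⟩
      rw [prtk]
      show ((prtk (ι := fun k => idx L M k) (prtQ L M) k (prtQ L M k u)).1 ν).val = (u.1 ν).val / lev L (k + 1)
      rw [h1 ν, show (prtQ L M k u).1 = par (lev L k) L M u.1 from rfl, val_par, Nat.div_div_eq_div_mul]
      rfl

/-- **`prtk prtQ k u = x` IS THE BLOCK CONDITION of `unitAvg_apply`** (component kept, site values divided by `n_k`). [folklore] -/
theorem prtk_prtQ_eq_iff (k : ℕ) (u : idx L M k) (x : idx L M 0) :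
    prtk (ι := fun k => idx L M k) (prtQ L M) k u = x ↔ (u.2 = x.2 ∧ ∀ ν, (u.1 ν).val / lev L k = (x.1 ν).val) := by
  obtain ⟨h2, h1⟩ := prtk_prtQ_spec L M k u
  constructor
  · rintro rfl
    exact ⟨h2.symm, fun ν => (h1 ν).symm⟩
  · rintro ⟨hc, hv⟩
    refine Prod.ext (funext fun ν => ZMod.val_injective _ ?_) (h2.trans hc)
    rw [h1 ν, hv ν]

omit [NeZero L] hM in
/-- the colour lift: `prtk prtQK k u = (prtk prtQ k u.1, u.2)`. [folklore] -/
theorem prtk_prtQK_eq : ∀ (k : ℕ) (u : idx L M k × o), prtk (ι := fun k => idx L M k × o) (prtQK L M o) k u = (prtk (ι := fun k => idx L M k) (prtQ L M) k u.1, u.2)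
  | 0, u => rfl
  | k + 1, u => by
      show prtk (ι := fun k => idx L M k × o) (prtQK L M o) k (prtQK L M o k u) = _
      rw [prtk_prtQK_eq k]
      rfl

/-- **the colour-lifted block condition**: `prtk prtQK k u = x ↔ colour kept ∧ component kept ∧ site values divided by `n_k`. [folklore] -/
theorem prtk_prtQK_eq_iff (k : ℕ) (u : idx L M k × o) (x : idx L M 0 × o) :
    prtk (ι := fun k => idx L M k × o) (prtQK L M o) k u = x ↔ (u.2 = x.2 ∧ u.1.2 = x.1.2 ∧ ∀ ν, (u.1.1 ν).val / lev L k = (x.1.1 ν).val) := by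
  rw [prtk_prtQK_eq, Prod.ext_iff, prtk_prtQ_eq_iff]
  simp only
  tauto

end KingParent

/-! ## §3 The block distance on the colour-lifted fine indices and the weighted row sums of `𝒢^{(k)} ⊗ 1` at `a = 1` -/

section Weights

open Literature.MathematicalPhysics.QuantumFieldTheory.Balaban1983to89.B5Prop11Plancherel (Cst Tor fine)
open Literature.MathematicalPhysics.QuantumFieldTheory.Balaban1983to89.B5G183RateUnitTower (lev)
open Literature.MathematicalPhysics.QuantumFieldTheory.Balaban1983to89.B4TorusKernel (periodConst)
open Literature.MathematicalPhysics.QuantumFieldTheory.Balaban1983to89.B4TorusKernel.MultiPeriod (torusSupNorm torusSupNorm_nonneg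
  circAbs circAbs_nonneg)
open Literature.MathematicalPhysics.QuantumFieldTheory.Balaban1983to89.B4Sect5Torus (circAbs_add_le)
open Literature.MathematicalPhysics.QuantumFieldTheory.Balaban1983to89.B4Sect5Proof (latticeConst latticeConst_nonneg)
open Literature.MathematicalPhysics.QuantumFieldTheory.Balaban1983to89.B5Blocks16 (blockOf blockOf_bpt bpt_bijective)
open Literature.MathematicalPhysics.QuantumFieldTheory.Balaban1983to89.B5Block118 (bpt)
open Literature.MathematicalPhysics.QuantumFieldTheory.Balaban1983to89.B5DeltaA169 (DeltaA calG_eq_DeltaA_inv)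
open Literature.MathematicalPhysics.QuantumFieldTheory.Balaban1983to89.B5G183Strip (kappa183 kappa183_pos)
open Literature.MathematicalPhysics.QuantumFieldTheory.Balaban1983to89.B5G183CovDecay (MD183 MD183_nonneg)
open Literature.MathematicalPhysics.QuantumFieldTheory.Balaban1983to89.B5Kernel166Decay (periodConst_pos)
open Literature.MathematicalPhysics.QuantumFieldTheory.Balaban1983to89.B6LowerBound2153Torus (rep)
open Literature.MathematicalPhysics.QuantumFieldTheory.Balaban1983to89.B6Cov2156Torus (one_le_M)
open Literature.MathematicalPhysics.QuantumFieldTheory.Balaban1983to89.B5G110BlockRowSum (weighted_row_sum_le')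
open Summit.QuantumFields.BalabanUV.T4Continuum.BalabanAveragedTowerUnit (idx calGlev one_le_lev')

variable {d : ℕ} (L : ℕ) [NeZero L] (M : Fin (d + 1) → ℕ) [hM : ∀ μ, NeZero (M μ)]
variable {o : Type*} [Fintype o] [DecidableEq o]

omit [NeZero L] in
/-- triangle inequality of the unit-torus sup-distance between blocks, read on value representatives. [folklore] -/
theorem torusSupNorm_rep_triangle (x y z : Tor M) :
    torusSupNorm M (rep M x - rep M z) ≤ torusSupNorm M (rep M x - rep M y) + torusSupNorm M (rep M y - rep M z) := by
  unfold torusSupNorm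
  refine Finset.sup'_le _ _ fun i _ => ?_
  have h := circAbs_add_le (one_le_M M i) (rep M x i - rep M y i) (rep M y i - rep M z i)
  have e : rep M x i - rep M y i + (rep M y i - rep M z i) = rep M x i - rep M z i := by ring
  rw [e] at h
  have h' : ((circAbs (M i) ((rep M x - rep M z) i) : ℤ) : ℝ)
      ≤ ((circAbs (M i) ((rep M x - rep M y) i) : ℤ) : ℝ) + ((circAbs (M i) ((rep M y - rep M z) i) : ℤ) : ℝ) := by
    simp only [Pi.sub_apply]; exact_mod_cast h
  refine h'.trans (add_le_add ?_ ?_)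
  · exact Finset.le_sup' (fun i => ((circAbs (M i) ((rep M x - rep M y) i) : ℤ) : ℝ)) (Finset.mem_univ i)
  · exact Finset.le_sup' (fun i => ((circAbs (M i) ((rep M y - rep M z) i) : ℤ) : ℝ)) (Finset.mem_univ i)

omit [NeZero L] in
/-- `0 ≤` the block distance. [folklore] -/
theorem torusSupNorm_rep_nonneg (x y : Tor M) : 0 ≤ torusSupNorm M (rep M x - rep M y) :=
  torusSupNorm_nonneg (one_le_M M) _

/-- **THE EXPONENTIALLY WEIGHTED ROW SUMS OF `𝒢^{(k)} ⊗ 1` AT `a = 1`** (pv15's `B5G110BlockRowSum.weighted_row_sum_le'` BY NAME at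
`n = n_k`, truncation order `N := d`; the colour lift is diagonal in colour): for every `δ′ < min(δ₁, δ₂)`, every `k` and every row
`(u, c)`, `Σ_{(v,c′)} e^{δ′·|blk u − blk v|_{T₁,∞}}·‖(𝒢^{(k)} ⊗ 1)((u,c),(v,c′))‖ ≤ WG(d, δ′)` — uniform in `k` and in the volume.
[cite: Balaban1984PropagatorsI, Prop. 1.2 (1.110) p.35 (location)] [folklore] -/
theorem wrow_calGlev_kron_le {δ' : ℝ} (h₁ : δ' < 1 / (2 * ((d : ℝ) + 1))) (h₂ : δ' < kappa183 (d + 1) / (d + 1))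
    (k : ℕ) (i : idx L M k × o) :
    ∑ j : idx L M k × o, Real.exp (δ' * torusSupNorm M (rep M (blockOf (lev L k) M i.1.1) - rep M (blockOf (lev L k) M j.1.1)))
        * ‖(calGlev L M 1 one_pos k ⊗ₖ (1 : Matrix o o ℂ)) i j‖
      ≤ 2 * d * 2 ^ d * Real.exp (1 / (2 * (d + 1))) * latticeConst (d + 1) (1 / (2 * (d + 1)) - δ')
        + (d + 1) * (MD183 (d + 1) d * periodConst (kappa183 (d + 1)) d * latticeConst (d + 1) (kappa183 (d + 1) / (d + 1) - δ')) := by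
  obtain ⟨u, c⟩ := i
  have hG : calGlev L M 1 one_pos k = (DeltaA (lev L k) M 1)⁻¹ := calG_eq_DeltaA_inv (lev L k) (one_le_lev' L k) M 1 one_pos
  have h1' : δ' < 1 / (2 * (d + 1)) := by simpa using h₁
  refine le_trans (le_of_eq ?_) (weighted_row_sum_le' (lev L k) (one_le_lev' L k) M (Nn := d) le_rfl h1' h₂ u)
  rw [Fintype.sum_prod_type]
  refine Finset.sum_congr rfl fun v _ => ?_
  rw [hG, Finset.sum_eq_single c]
  · simp [Matrix.kroneckerMap_apply]
  · intro c' _ hc'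
    simp [Matrix.kroneckerMap_apply, Ne.symm hc']
  · simp

end Weights

/-! ## §4 `hdec` AT SMALL COUPLING for perturbations with level-uniform weighted row sums -/

section Small

open Literature.MathematicalPhysics.QuantumFieldTheory.Balaban1983to89.B5Prop11Plancherel (Cst Tor fine)
open Literature.MathematicalPhysics.QuantumFieldTheory.Balaban1983to89.B5G183RateUnitTower (lev)
open Literature.MathematicalPhysics.QuantumFieldTheory.Balaban1983to89.B4TorusKernel (periodConst)
open Literature.MathematicalPhysics.QuantumFieldTheory.Balaban1983to89.B4TorusKernel.MultiPeriod (torusSupNorm torusSupNorm_nonneg)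
open Literature.MathematicalPhysics.QuantumFieldTheory.Balaban1983to89.B4Sect5Proof (latticeConst latticeConst_nonneg)
open Literature.MathematicalPhysics.QuantumFieldTheory.Balaban1983to89.B5Blocks16 (blockOf blockOf_bpt bpt_bijective)
open Literature.MathematicalPhysics.QuantumFieldTheory.Balaban1983to89.B5Block118 (bpt)
open Literature.MathematicalPhysics.QuantumFieldTheory.Balaban1983to89.B5G183Strip (kappa183 kappa183_pos)
open Literature.MathematicalPhysics.QuantumFieldTheory.Balaban1983to89.B5G183CovDecay (MD183 MD183_nonneg)
open Literature.MathematicalPhysics.QuantumFieldTheory.Balaban1983to89.B6LowerBound2153Torus (rep)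
open Literature.MathematicalPhysics.QuantumFieldTheory.Balaban1983to89.B6Cov2156Torus (one_le_M)
open Summit.QuantumFields.BalabanUV.T4Continuum
open Summit.QuantumFields.BalabanUV.T4Continuum.BalabanAveragedTowerUnit (idx Qlev calGlev one_le_lev')
open Summit.QuantumFields.BalabanUV.T4Continuum.KingPairingPlantedLaw (calDalev calDalev_inv isUnit_det_calDalev)
open Summit.QuantumFields.BalabanUV.T4Continuum.KroneckerLift (kron_inv isUnit_det_kron)
open Summit.QuantumFields.BalabanUV.T4Continuum.NE2ColourPerturbedLayer (pertCovC)
open Summit.QuantumFields.BalabanUV.T4Continuum.DecayRateInterpolation (EntryDecay)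
open Summit.QuantumFields.BalabanUV.T4Continuum.BlockSumDecay (prtk prtQ prtQK BlockL1Decay hdec_pertCovC_of_blockL1)
open Summit.QuantumFields.BalabanUV.T4Continuum.FreeTowerEntryDecay (val_toTor rep_toTor block_cond_iff sum_block_comp_ite_const)
open Literature.MathematicalPhysics.QuantumFieldTheory.Balaban1983to89.B4TorusKernel.MultiPeriod (circAbs)
open Literature.MathematicalPhysics.QuantumFieldTheory.Balaban1983to89.B4Sect5Torus (circAbs_zero)

variable {d : ℕ} (L : ℕ) [NeZero L] (M : Fin (d + 1) → ℕ) [hM : ∀ μ, NeZero (M μ)]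
variable {o : Type*} [Fintype o] [DecidableEq o]

/-- **WEIGHTED ROW SUMS OF THE PERTURBED FINE PROPAGATORS AT SMALL COUPLING** (`a = 1`, dimension `d + 1`): if every level's
perturbation has weighted row sums `≤ π` for the block distance at rate `δ′ < min(δ₁, δ₂)`, then for `‖t‖·WG·π < 1` the colour-lifted
perturbed fine propagator `(Δ_1^{(k)} ⊗ 1 + t·P_k)⁻¹` exists and has weighted row sums `≤ WG/(1 − ‖t‖·WG·π)` at EVERY level — the
resolvent identity in the weighted row-sum norm (§1). [folklore] -/
theorem wrow_pert_inv_le {δ' : ℝ} (hδ0 : 0 ≤ δ') (h₁ : δ' < 1 / (2 * ((d : ℝ) + 1))) (h₂ : δ' < kappa183 (d + 1) / (d + 1))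
    {P : (k : ℕ) → Matrix (idx L M k × o) (idx L M k × o) ℂ} {π : ℝ}
    (hP : ∀ k (i : idx L M k × o), ∑ j, Real.exp (δ' * torusSupNorm M
        (rep M (blockOf (lev L k) M i.1.1) - rep M (blockOf (lev L k) M j.1.1))) * ‖P k i j‖ ≤ π)
    {t : ℂ} (ht : ‖t‖ * (2 * d * 2 ^ d * Real.exp (1 / (2 * (d + 1))) * latticeConst (d + 1) (1 / (2 * (d + 1)) - δ')
        + (d + 1) * (MD183 (d + 1) d * periodConst (kappa183 (d + 1)) d * latticeConst (d + 1) (kappa183 (d + 1) / (d + 1) - δ')))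
        * π < 1) (k : ℕ) (i : idx L M k × o) :
    IsUnit (calDalev L M 1 one_pos k ⊗ₖ (1 : Matrix o o ℂ) + t • P k).det ∧
      ∑ j, Real.exp (δ' * torusSupNorm M (rep M (blockOf (lev L k) M i.1.1) - rep M (blockOf (lev L k) M j.1.1)))
          * ‖(calDalev L M 1 one_pos k ⊗ₖ (1 : Matrix o o ℂ) + t • P k)⁻¹ i j‖
        ≤ (2 * d * 2 ^ d * Real.exp (1 / (2 * (d + 1))) * latticeConst (d + 1) (1 / (2 * (d + 1)) - δ')
            + (d + 1) * (MD183 (d + 1) d * periodConst (kappa183 (d + 1)) d * latticeConst (d + 1) (kappa183 (d + 1) / (d + 1) - δ')))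
          / (1 - ‖t‖ * (2 * d * 2 ^ d * Real.exp (1 / (2 * (d + 1))) * latticeConst (d + 1) (1 / (2 * (d + 1)) - δ')
            + (d + 1) * (MD183 (d + 1) d * periodConst (kappa183 (d + 1)) d * latticeConst (d + 1) (kappa183 (d + 1) / (d + 1) - δ')))
            * π) := by
  have hD : IsUnit (calDalev L M 1 one_pos k ⊗ₖ (1 : Matrix o o ℂ)).det := isUnit_det_kron o (isUnit_det_calDalev L M 1 one_pos k)
  have hinv : (calDalev L M 1 one_pos k ⊗ₖ (1 : Matrix o o ℂ))⁻¹ = calGlev L M 1 one_pos k ⊗ₖ (1 : Matrix o o ℂ) := by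
    rw [kron_inv, calDalev_inv]
  refine wrow_inv_add_smul_le (ρ := fun i j : idx L M k × o =>
      torusSupNorm M (rep M (blockOf (lev L k) M i.1.1) - rep M (blockOf (lev L k) M j.1.1)))
    (fun i j m => torusSupNorm_rep_triangle M _ _ _) (fun i j => torusSupNorm_rep_nonneg M _ _) hδ0 hD
    (fun i => ?_) (hP k) ht i
  rw [hinv]
  exact wrow_calGlev_kron_le L M h₁ h₂ k i

omit [NeZero L] in
/-- `n_k^{d+1} = (L^{d+1})^k` in `ℝ`. [folklore] -/
theorem cast_lev_pow (k : ℕ) : (((lev L k : ℕ) : ℝ)) ^ (d + 1) = ((L : ℝ) ^ (d + 1)) ^ k := by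
  rw [BalabanAveragedTowerUnit.cast_lev' L k, ← pow_mul, ← pow_mul, mul_comm]

omit [Fintype o] [DecidableEq o] in
/-- a site of the block of `x` (iterated parent `= x`) lies in the unit block `⟦x.1.1⟧`. [folklore] -/
theorem blockOf_of_prtk_eq {k : ℕ} {u : idx L M k × o} {x : idx L M 0 × o}
    (h : prtk (ι := fun k => idx L M k × o) (prtQK L M o) k u = x) :
    blockOf (lev L k) M u.1.1 = (fun ν => ((x.1.1 ν).val : ZMod (M ν))) :=
  (block_cond_iff L M u.1.1 x.1.1).mp ((prtk_prtQK_eq_iff L M k u x).mp h).2.2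

/-- **WEIGHTED ROW SUMS ⟹ THE OWNER's `BlockL1Decay`**: a level-uniform exponentially weighted row-sum bound `W` for a tower `X_k`
of colour-lifted fine kernels gives block-ℓ¹ decay `(W, δ′)` against the unit-torus sup-distance — the `n_k^{d+1} = (L^{d+1})^k`
rows of a block each contribute `≤ e^{−δ′·dist}·W`. [folklore] -/
theorem blockL1Decay_of_wrow {X : (k : ℕ) → Matrix (idx L M k × o) (idx L M k × o) ℂ} {δ' W : ℝ}
    (hX : ∀ k (i : idx L M k × o), ∑ j, Real.exp (δ' * torusSupNorm M
        (rep M (blockOf (lev L k) M i.1.1) - rep M (blockOf (lev L k) M j.1.1))) * ‖X k i j‖ ≤ W) :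
    BlockL1Decay (ι := fun k => idx L M k × o) (prtQK L M o) ((L : ℝ) ^ (d + 1))
      (fun x y : idx L M 0 × o => torusSupNorm M (fun ν => (((x.1.1 ν).val : ℕ) : ℤ) - (((y.1.1 ν).val : ℕ) : ℤ))) X W δ' := by
  intro k x y
  set D : ℝ := torusSupNorm M (fun ν => (((x.1.1 ν).val : ℕ) : ℤ) - (((y.1.1 ν).val : ℕ) : ℤ)) with hD
  set Fx := Finset.univ.filter (fun u : idx L M k × o => prtk (ι := fun k => idx L M k × o) (prtQK L M o) k u = x) with hFx
  set Fy := Finset.univ.filter (fun v : idx L M k × o => prtk (ι := fun k => idx L M k × o) (prtQK L M o) k v = y) with hFy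
  have hW : 0 ≤ W := le_trans (Finset.sum_nonneg fun j _ => mul_nonneg (Real.exp_pos _).le (norm_nonneg _)) (hX 0 x)
  -- on `Fx × Fy` the block distance IS `D`
  have hρ : ∀ u ∈ Fx, ∀ v ∈ Fy,
      torusSupNorm M (rep M (blockOf (lev L k) M u.1.1) - rep M (blockOf (lev L k) M v.1.1)) = D := by
    intro u hu v hv
    rw [hFx, Finset.mem_filter] at hu
    rw [hFy, Finset.mem_filter] at hv
    rw [blockOf_of_prtk_eq L M hu.2, blockOf_of_prtk_eq L M hv.2, rep_toTor, rep_toTor]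
    rfl
  -- inner sums
  have hin : ∀ u ∈ Fx, ∑ v ∈ Fy, ‖X k u v‖ ≤ Real.exp (-(δ' * D)) * W := by
    intro u hu
    calc ∑ v ∈ Fy, ‖X k u v‖
        = ∑ v ∈ Fy, Real.exp (-(δ' * D)) * (Real.exp (δ' * torusSupNorm M
            (rep M (blockOf (lev L k) M u.1.1) - rep M (blockOf (lev L k) M v.1.1))) * ‖X k u v‖) := by
          refine Finset.sum_congr rfl fun v hv => ?_
          rw [hρ u hu v hv, ← mul_assoc, ← Real.exp_add, neg_add_cancel, Real.exp_zero, one_mul]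
      _ = Real.exp (-(δ' * D)) * ∑ v ∈ Fy, Real.exp (δ' * torusSupNorm M
            (rep M (blockOf (lev L k) M u.1.1) - rep M (blockOf (lev L k) M v.1.1))) * ‖X k u v‖ := by rw [Finset.mul_sum]
      _ ≤ Real.exp (-(δ' * D)) * W := by
          refine mul_le_mul_of_nonneg_left (le_trans ?_ (hX k u)) (Real.exp_pos _).le
          exact Finset.sum_le_univ_sum_of_nonneg fun v => mul_nonneg (Real.exp_pos _).le (norm_nonneg _)
  -- the number of rows of the block
  have hcard : ∑ u ∈ Fx, Real.exp (-(δ' * D)) * W = (((lev L k : ℕ) : ℝ)) ^ (d + 1) * (Real.exp (-(δ' * D)) * W) := by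
    rw [hFx, Finset.sum_filter]
    simp_rw [prtk_prtQK_eq_iff]
    rw [Fintype.sum_prod_type, ← sum_block_comp_ite_const L M x.1.1 x.1.2 (Real.exp (-(δ' * D)) * W)]
    refine Finset.sum_congr rfl fun u1 _ => ?_
    by_cases h : (u1.2 = x.1.2 ∧ ∀ ν, (u1.1 ν).val / lev L k = (x.1.1 ν).val)
    · rw [if_pos h]
      have e : ∀ c : o, ((u1, c).2 = x.2 ∧ (u1, c).1.2 = x.1.2 ∧ ∀ ν, ((u1, c).1.1 ν).val / lev L k = (x.1.1 ν).val) ↔ c = x.2 :=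
        fun c => ⟨fun hc => hc.1, fun hc => ⟨hc, h.1, h.2⟩⟩
      simp_rw [e]
      rw [Finset.sum_ite_eq']; simp
    · rw [if_neg h]
      exact Finset.sum_eq_zero fun c _ => if_neg fun hc => h ⟨hc.2.1, hc.2.2⟩
  calc ∑ u ∈ Fx, ∑ v ∈ Fy, ‖X k u v‖ ≤ ∑ u ∈ Fx, Real.exp (-(δ' * D)) * W := Finset.sum_le_sum hin
    _ = (((lev L k : ℕ) : ℝ)) ^ (d + 1) * (Real.exp (-(δ' * D)) * W) := hcard
    _ = W * ((L : ℝ) ^ (d + 1)) ^ k * Real.exp (-(δ' * D)) := by rw [cast_lev_pow]; ring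

/-- **`hdec` AT SMALL COUPLING** (`a = 1`, dimension `d + 1`): for a perturbation family with level-uniform weighted row sums
`≤ π` at a rate `0 ≤ δ′ < min(δ₁, δ₂)` and every coupling with `‖t‖·WG(δ′)·π < 1`, the King-averaged colour tower `pertCovC P t k` has
the LEVEL-UNIFORM entry decay `(WG/(1 − ‖t‖·WG·π), δ′)` against the unit-torus sup-distance — the owner's
`BlockSumDecay.hdec_pertCovC_of_blockL1` BY NAME on `blockL1Decay_of_wrow` + `wrow_pert_inv_le`.  MODEL level (bounded ∕
finite-range perturbations; NOT tier B's unbounded first-order pieces); sub-row Δ3 NOT closed; NE2 NOT proved. [folklore] -/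
theorem hdec_pertCovC_small {δ' : ℝ} (hδ0 : 0 ≤ δ') (h₁ : δ' < 1 / (2 * ((d : ℝ) + 1))) (h₂ : δ' < kappa183 (d + 1) / (d + 1))
    {P : (k : ℕ) → Matrix (idx L M k × o) (idx L M k × o) ℂ} {π : ℝ}
    (hP : ∀ k (i : idx L M k × o), ∑ j, Real.exp (δ' * torusSupNorm M
        (rep M (blockOf (lev L k) M i.1.1) - rep M (blockOf (lev L k) M j.1.1))) * ‖P k i j‖ ≤ π)
    {t : ℂ} (ht : ‖t‖ * (2 * d * 2 ^ d * Real.exp (1 / (2 * (d + 1))) * latticeConst (d + 1) (1 / (2 * (d + 1)) - δ')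
        + (d + 1) * (MD183 (d + 1) d * periodConst (kappa183 (d + 1)) d * latticeConst (d + 1) (kappa183 (d + 1) / (d + 1) - δ')))
        * π < 1) (k : ℕ) :
    EntryDecay (fun x y : idx L M 0 × o => torusSupNorm M (fun ν => (((x.1.1 ν).val : ℕ) : ℤ) - (((y.1.1 ν).val : ℕ) : ℤ)))
      (pertCovC L M 1 one_pos P t k)
      ((2 * d * 2 ^ d * Real.exp (1 / (2 * (d + 1))) * latticeConst (d + 1) (1 / (2 * (d + 1)) - δ')
            + (d + 1) * (MD183 (d + 1) d * periodConst (kappa183 (d + 1)) d * latticeConst (d + 1) (kappa183 (d + 1) / (d + 1) - δ')))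
          / (1 - ‖t‖ * (2 * d * 2 ^ d * Real.exp (1 / (2 * (d + 1))) * latticeConst (d + 1) (1 / (2 * (d + 1)) - δ')
            + (d + 1) * (MD183 (d + 1) d * periodConst (kappa183 (d + 1)) d * latticeConst (d + 1) (kappa183 (d + 1) / (d + 1) - δ')))
            * π))
      δ' :=
  hdec_pertCovC_of_blockL1 L M o 1 one_pos
    (blockL1Decay_of_wrow L M (fun k i => (wrow_pert_inv_le L M hδ0 h₁ h₂ hP ht k i).2)) k

/-- **THE SIMPLEST INSTANCE — BOUNDED POTENTIALS (zeroth-order perturbations)**: a diagonal family `P_k = diag(w_k)` with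
`‖w_k(i)‖ ≤ α` has weighted row sums `≤ α` at every rate (only the diagonal term survives; the block distance of a site to itself is
`0`).  So `hdec_pertCovC_small` applies to every bounded potential at couplings `‖t‖ < (α·WG)⁻¹`. [folklore] -/
theorem wrow_diagonal_le {k : ℕ} (w : idx L M k × o → ℂ) {α : ℝ} (hw : ∀ i, ‖w i‖ ≤ α) (δ' : ℝ) (i : idx L M k × o) :
    ∑ j, Real.exp (δ' * torusSupNorm M (rep M (blockOf (lev L k) M i.1.1) - rep M (blockOf (lev L k) M j.1.1)))
        * ‖(Matrix.diagonal w) i j‖ ≤ α := by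
  rw [Finset.sum_eq_single i]
  · have h0 : torusSupNorm M (rep M (blockOf (lev L k) M i.1.1) - rep M (blockOf (lev L k) M i.1.1)) = 0 := by
      rw [sub_self]
      unfold torusSupNorm
      refine le_antisymm (Finset.sup'_le _ _ fun ν _ => ?_) ?_
      · rw [Pi.zero_apply, circAbs_zero, Int.cast_zero]
      · refine le_trans ?_ (Finset.le_sup' (fun ν => ((circAbs (M ν) ((0 : Fin (d + 1) → ℤ) ν) : ℤ) : ℝ))
          (Finset.mem_univ (0 : Fin (d + 1))))
        rw [Pi.zero_apply, circAbs_zero, Int.cast_zero]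
    rw [h0, mul_zero, Real.exp_zero, one_mul, Matrix.diagonal_apply_eq]
    exact hw i
  · intro j _ hj
    rw [Matrix.diagonal_apply_ne _ (Ne.symm hj), norm_zero, mul_zero]
  · intro h; exact absurd (Finset.mem_univ i) h

open Summit.QuantumFields.BalabanUV.T4Continuum.BackgroundResolventTower
open Summit.QuantumFields.BalabanUV.T4Continuum.KingPairingPlantedLaw (JpcT CJ)
open Summit.QuantumFields.BalabanUV.T4Continuum.NE2ColourPerturbedLayer (pertLimC)
open Summit.QuantumFields.BalabanUV.T4Continuum.DecayRateInterpolation (DecayRate TwoLevelDecayRate)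
open Summit.QuantumFields.BalabanUV.T4Continuum.NE2BalabanDecayRate (decayStations_pertCovC)

/-- **THE OWNER's DECAY STATIONS AT SMALL COUPLING** (`L ≥ 2`, `a = 1`, dimension `d + 1`): for a family obeying the rate-`L⁻¹`
perturbation laws (`κ`, `C₂`) AND the level-uniform weighted row-sum bound `π`, and a coupling in both discs (`‖t‖κ < 1`,
`‖t‖·WG·π < 1`): limit entry decay of `pertLimC P t` and King's (4.38) limit ∕ two-level shapes —
`NE2BalabanDecayRate.decayStations_pertCovC` BY NAME with `hdec := hdec_pertCovC_small`.  MODEL level; Δ3 NOT closed; NE2 NOT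
proved. [cite: King1986, Lemma 4.5 (4.38) p.674 (shape)] [folklore] -/
theorem decayStations_pertCovC_small (hL : 2 ≤ L) {δ' : ℝ} (hδ0 : 0 ≤ δ') (h₁ : δ' < 1 / (2 * ((d : ℝ) + 1)))
    (h₂ : δ' < kappa183 (d + 1) / (d + 1))
    {P : (k : ℕ) → Matrix (idx L M k × o) (idx L M k × o) ℂ} {κ C₂ π : ℝ}
    (hpert : PerturbationLaws (fun k => calDalev L M 1 one_pos k ⊗ₖ (1 : Matrix o o ℂ)) P
      (fun k => JpcT L M k ⊗ₖ (1 : Matrix o o ℂ)) κ (fun k => C₂ * ((L : ℝ)⁻¹) ^ k))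
    (hP : ∀ k (i : idx L M k × o), ∑ j, Real.exp (δ' * torusSupNorm M
        (rep M (blockOf (lev L k) M i.1.1) - rep M (blockOf (lev L k) M j.1.1))) * ‖P k i j‖ ≤ π)
    {t : ℂ} (htκ : ‖t‖ * κ < 1) (ht : ‖t‖ * (2 * d * 2 ^ d * Real.exp (1 / (2 * (d + 1))) * latticeConst (d + 1) (1 / (2 * (d + 1)) - δ')
            + (d + 1) * (MD183 (d + 1) d * periodConst (kappa183 (d + 1)) d * latticeConst (d + 1) (kappa183 (d + 1) / (d + 1) - δ'))) * π < 1) :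
    EntryDecay (fun x y : idx L M 0 × o => torusSupNorm M (fun ν => (((x.1.1 ν).val : ℕ) : ℤ) - (((y.1.1 ν).val : ℕ) : ℤ)))
        (pertLimC L M 1 one_pos P t) ((2 * d * 2 ^ d * Real.exp (1 / (2 * (d + 1))) * latticeConst (d + 1) (1 / (2 * (d + 1)) - δ')
            + (d + 1) * (MD183 (d + 1) d * periodConst (kappa183 (d + 1)) d * latticeConst (d + 1) (kappa183 (d + 1) / (d + 1) - δ')))
          / (1 - ‖t‖ * (2 * d * 2 ^ d * Real.exp (1 / (2 * (d + 1))) * latticeConst (d + 1) (1 / (2 * (d + 1)) - δ')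
            + (d + 1) * (MD183 (d + 1) d * periodConst (kappa183 (d + 1)) d * latticeConst (d + 1) (kappa183 (d + 1) / (d + 1) - δ'))) * π)) δ' ∧
      DecayRate (fun x y : idx L M 0 × o => torusSupNorm M (fun ν => (((x.1.1 ν).val : ℕ) : ℤ) - (((y.1.1 ν).val : ℕ) : ℤ)))
        (pertCovC L M 1 one_pos P t) (pertLimC L M 1 one_pos P t)
        (Real.sqrt (2 * ((2 * d * 2 ^ d * Real.exp (1 / (2 * (d + 1))) * latticeConst (d + 1) (1 / (2 * (d + 1)) - δ')
            + (d + 1) * (MD183 (d + 1) d * periodConst (kappa183 (d + 1)) d * latticeConst (d + 1) (kappa183 (d + 1) / (d + 1) - δ')))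
          / (1 - ‖t‖ * (2 * d * 2 ^ d * Real.exp (1 / (2 * (d + 1))) * latticeConst (d + 1) (1 / (2 * (d + 1)) - δ')
            + (d + 1) * (MD183 (d + 1) d * periodConst (kappa183 (d + 1)) d * latticeConst (d + 1) (kappa183 (d + 1) / (d + 1) - δ'))) * π)) * (Cpert κ (2 * ((d + 1 : ℕ) : ℝ) * Cst (d + 1) 1) (CJ (d + 1) 1) C₂ 0 t / (1 - (L : ℝ)⁻¹)))) (δ' / 2) (Real.sqrt ((L : ℝ)⁻¹)) ∧
      TwoLevelDecayRate (fun x y : idx L M 0 × o => torusSupNorm M (fun ν => (((x.1.1 ν).val : ℕ) : ℤ) - (((y.1.1 ν).val : ℕ) : ℤ)))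
        (pertCovC L M 1 one_pos P t)
        (Real.sqrt (2 * ((2 * d * 2 ^ d * Real.exp (1 / (2 * (d + 1))) * latticeConst (d + 1) (1 / (2 * (d + 1)) - δ')
            + (d + 1) * (MD183 (d + 1) d * periodConst (kappa183 (d + 1)) d * latticeConst (d + 1) (kappa183 (d + 1) / (d + 1) - δ')))
          / (1 - ‖t‖ * (2 * d * 2 ^ d * Real.exp (1 / (2 * (d + 1))) * latticeConst (d + 1) (1 / (2 * (d + 1)) - δ')
            + (d + 1) * (MD183 (d + 1) d * periodConst (kappa183 (d + 1)) d * latticeConst (d + 1) (kappa183 (d + 1) / (d + 1) - δ'))) * π)) * (2 * Cpert κ (2 * ((d + 1 : ℕ) : ℝ) * Cst (d + 1) 1) (CJ (d + 1) 1) C₂ 0 t / (1 - (L : ℝ)⁻¹)))) (δ' / 2) (Real.sqrt ((L : ℝ)⁻¹)) :=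
  decayStations_pertCovC L M 1 one_pos hL hpert htκ (hdec_pertCovC_small L M hδ0 h₁ h₂ hP ht)

/-- **NON-VACUITY IN THE KERNEL — BOUNDED POTENTIALS**: for `P_k = diag(w_k)`, `‖w_k(i)‖ ≤ α`, and `‖t‖·W_G·α < 1` the hypotheses of
`hdec_pertCovC_small` are met (`wrow_diagonal_le`), so `hdec` holds at every such coupling (kernel `example`). [folklore] -/
example {δ' : ℝ} (hδ0 : 0 ≤ δ') (h₁ : δ' < 1 / (2 * ((d : ℝ) + 1))) (h₂ : δ' < kappa183 (d + 1) / (d + 1))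
    (w : (k : ℕ) → idx L M k × o → ℂ) {α : ℝ} (hw : ∀ k i, ‖w k i‖ ≤ α) {t : ℂ}
    (ht : ‖t‖ * (2 * d * 2 ^ d * Real.exp (1 / (2 * (d + 1))) * latticeConst (d + 1) (1 / (2 * (d + 1)) - δ')
            + (d + 1) * (MD183 (d + 1) d * periodConst (kappa183 (d + 1)) d * latticeConst (d + 1) (kappa183 (d + 1) / (d + 1) - δ'))) * α < 1) (k : ℕ) :
    EntryDecay (fun x y : idx L M 0 × o => torusSupNorm M (fun ν => (((x.1.1 ν).val : ℕ) : ℤ) - (((y.1.1 ν).val : ℕ) : ℤ)))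
      (pertCovC L M 1 one_pos (fun k => Matrix.diagonal (w k)) t k)
      ((2 * d * 2 ^ d * Real.exp (1 / (2 * (d + 1))) * latticeConst (d + 1) (1 / (2 * (d + 1)) - δ')
            + (d + 1) * (MD183 (d + 1) d * periodConst (kappa183 (d + 1)) d * latticeConst (d + 1) (kappa183 (d + 1) / (d + 1) - δ')))
          / (1 - ‖t‖ * (2 * d * 2 ^ d * Real.exp (1 / (2 * (d + 1))) * latticeConst (d + 1) (1 / (2 * (d + 1)) - δ')
            + (d + 1) * (MD183 (d + 1) d * periodConst (kappa183 (d + 1)) d * latticeConst (d + 1) (kappa183 (d + 1) / (d + 1) - δ'))) * α)) δ' :=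
  hdec_pertCovC_small L M hδ0 h₁ h₂ (fun k i => wrow_diagonal_le L M (w k) (hw k) δ' i) ht k

end Small


end Summit.QuantumFields.BalabanUV.T4Continuum.SmallCouplingEntryDecay

end
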